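/-
Copyright: fleet lead `ym-wcr-19609-p1` (seat prover-ym-wcr-19609-p1-g0-0), route `WeakCouplingRates`, crux
`BulkDominatesColdBoxW` (stmt-QuantumFields-19609), line `dlr-chessboard` (skeleton sha16 021c654069d76526).
-/
import Summits.QuantumFields.YangMills.Theses.WeakCouplingRates
import Summits.QuantumFields.YangMills.Theorems.WeakCouplingRatesBulkDominatesColdBoxWDefs

/-!
# Stub `stub_boxPolyFloor` of crux `BulkDominatesColdBoxW` (stmt-QuantumFields-19609) REDUCED to the route's items
# BOX_W (`ColdBoxTwoPointFloorW`, stmt-QuantumFields-19608) and FLOOR (`CurvatureCorrPowerFloor`, stmt-QuantumFields-19457)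

The line `dlr-chessboard` registers `stub_boxPolyFloor : ∃ θ₁ > 0, ∀ 0 < θ ≤ θ₁, BoxPolyFloor (θ/20) θ (2 + θ/2)` — the cold-wall
box covariance at separation `⌈β^{θ/20}⌉` in the box of side `2⌈β^θ⌉+1` is eventually `≥ β^{−(2+θ/2)}`.  Its card says it is «NOT
independent content: it is the route's crux BOX_W + support FLOOR + rpow arithmetic».  This file proves exactly that implication,
`boxPolyFloor_of_box_floor : ColdBoxTwoPointFloorW → CurvatureCorrPowerFloor → (∃ θ₁ > 0, ∀ 0 < θ ≤ θ₁, BoxPolyFloor (θ/20) θ (2+θ/2))`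
(with `θ₁ :=` BOX_W's ceiling `θ₀`): `β²·boxPlaqCov ≥ c·C(T)² ≥ c·κ²/T⁸ ≥ (cκ²/256)·β^{−8A}`, `A = θ/20`, `T = ⌈β^A⌉ ≤ 2β^A`, and
`(cκ²/256)·β^{−2−0.4θ} ≥ β^{−2−θ/2}` for `β ≥ (256/(cκ²))^{10/θ}`.  The day items 19608 and 19457 close (`…_holds` theorems), the
registered stub is the three-line corollary.  NOT a claim about the mass gap; nothing here is analytic.
-/

set_option autoImplicit false

noncomputable section

open Filter Topology
open Literature.MathematicalPhysics.QuantumFieldTheory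
open Literature.MathematicalPhysics.QuantumLattice
open Summit.QuantumFields.YangMills.Theses.WeakCouplingRates (ColdBoxTwoPointFloorW CurvatureCorrPowerFloor)

namespace Summit.QuantumFields.YangMills.Theorems.WeakCouplingRates

/-- **`stub_boxPolyFloor` from BOX_W and FLOOR**: if `ColdBoxTwoPointFloorW` (ceiling `θ₀`) and `CurvatureCorrPowerFloor` hold, then for
every `0 < θ ≤ θ₀` the cold-wall box covariance satisfies `β^{−(2+θ/2)} ≤ boxPlaqCov ρ β ⌈β^θ⌉ ⌈β^{θ/20}⌉` for all large `β`
(rpow arithmetic: `c κ² / 256 · β^{−2−0.4θ} ≥ β^{−2−θ/2}` eventually). [folklore] -/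
theorem boxPolyFloor_of_box_floor (hBox : ColdBoxTwoPointFloorW) (hFloor : CurvatureCorrPowerFloor) :
    ∃ θ₁ : ℝ, 0 < θ₁ ∧ ∀ θ : ℝ, 0 < θ → θ ≤ θ₁ → BoxPolyFloor (θ / 20) θ (2 + θ / 2) := by
  obtain ⟨θ₀, hθ₀, hbox⟩ := hBox
  obtain ⟨κ, hκ, n₀, hfloor⟩ := hFloor
  refine ⟨θ₀, hθ₀, fun θ hθ hθ1 => ?_⟩
  have hA : 0 < θ / 20 := by positivity
  have hAθ : θ / 20 < θ := by linarith
  obtain ⟨c, hc, β₁, hdom⟩ := hbox (θ / 20) θ hA hAθ hθ1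
  -- `⌈β^A⌉ ≥ n₀` and `c κ²/256 ≥ β^{-θ/10}` eventually
  have hT : Tendsto (fun β : ℝ => β ^ (θ / 20)) atTop atTop := tendsto_rpow_atTop hA
  have hev1 : ∀ᶠ β : ℝ in atTop, (n₀ : ℝ) ≤ β ^ (θ / 20) := hT.eventually_ge_atTop _
  have hsmall : Tendsto (fun β : ℝ => β ^ (-(θ / 10))) atTop (𝓝 0) := tendsto_rpow_neg_atTop (by positivity)
  have hev2 : ∀ᶠ β : ℝ in atTop, β ^ (-(θ / 10)) < c * κ ^ 2 / 256 := hsmall.eventually (gt_mem_nhds (by positivity))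
  obtain ⟨β₂, hβ₂⟩ := Filter.eventually_atTop.1 (hev1.and hev2)
  refine ⟨max (max β₁ β₂) 1, fun β hβ => ?_⟩
  simp only [max_le_iff] at hβ
  obtain ⟨⟨hb1, hb2⟩, hb3⟩ := hβ
  have hβ0 : 0 < β := by linarith
  obtain ⟨hn₀, hcκ⟩ := hβ₂ β hb2
  have hd := hdom β hb1
  -- the floor at `T = ⌈β^A⌉`
  obtain ⟨hT1, hT2⟩ := one_le_ceil_rpow_and_le hb3 hA.le
  have hTn : n₀ ≤ ⌈β ^ (θ / 20)⌉₊ := by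
    have : (n₀ : ℝ) ≤ (⌈β ^ (θ / 20)⌉₊ : ℝ) := hn₀.trans (Nat.le_ceil _)
    exact_mod_cast this
  have hC := hfloor _ hTn
  have hTpos : (0 : ℝ) < (⌈β ^ (θ / 20)⌉₊ : ℝ) := by linarith
  -- `C(T)² ≥ κ² / T⁸ ≥ κ² / (256 β^{8A})`
  have hC2 : κ ^ 2 / ((⌈β ^ (θ / 20)⌉₊ : ℝ) ^ 4) ^ 2 ≤
      curvaturePlaquetteCorr (d := 4) (by norm_num) (⌈β ^ (θ / 20)⌉₊ : ℤ) ^ 2 := by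
    have h1 : κ / (⌈β ^ (θ / 20)⌉₊ : ℝ) ^ 4 ≤ |curvaturePlaquetteCorr (d := 4) (by norm_num) (⌈β ^ (θ / 20)⌉₊ : ℤ)| := by
      simpa using hC
    have h0 : 0 ≤ κ / (⌈β ^ (θ / 20)⌉₊ : ℝ) ^ 4 := by positivity
    have h2 := pow_le_pow_left₀ h0 h1 2
    rw [sq_abs, div_pow] at h2
    exact h2
  have hT8 : ((⌈β ^ (θ / 20)⌉₊ : ℝ) ^ 4) ^ 2 ≤ 256 * β ^ (8 * (θ / 20)) := by
    have h := pow_le_pow_left₀ hTpos.le hT2 8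
    rw [← pow_mul]
    norm_num
    calc (⌈β ^ (θ / 20)⌉₊ : ℝ) ^ 8 ≤ (2 * β ^ (θ / 20)) ^ 8 := h
      _ = 256 * (β ^ (θ / 20)) ^ 8 := by rw [mul_pow]; norm_num
      _ = 256 * β ^ (8 * (θ / 20)) := by
          rw [← Real.rpow_natCast (β ^ (θ / 20)) 8, ← Real.rpow_mul hβ0.le]; norm_num; ring_nf
  have hsig : c * κ ^ 2 / (256 * β ^ (8 * (θ / 20))) ≤ β ^ 2 * boxPlaqCov (fundamentalRep (Fin 2)) β ⌈β ^ θ⌉₊ ⌈β ^ (θ / 20)⌉₊ := by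
    have hpos8 : (0 : ℝ) < ((⌈β ^ (θ / 20)⌉₊ : ℝ) ^ 4) ^ 2 := by positivity
    calc c * κ ^ 2 / (256 * β ^ (8 * (θ / 20))) ≤ c * (κ ^ 2 / ((⌈β ^ (θ / 20)⌉₊ : ℝ) ^ 4) ^ 2) := by
          rw [mul_div_assoc]
          exact mul_le_mul_of_nonneg_left (div_le_div_of_nonneg_left (sq_nonneg κ) hpos8 hT8) hc.le
      _ ≤ c * curvaturePlaquetteCorr (d := 4) (by norm_num) (⌈β ^ (θ / 20)⌉₊ : ℤ) ^ 2 :=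
          mul_le_mul_of_nonneg_left hC2 hc.le
      _ ≤ _ := hd
  -- rpow bookkeeping: `β^{-(2+θ/2)} ≤ (cκ²/256) β^{-2-0.4θ}`
  have hβ2 : (0 : ℝ) < β ^ (2 : ℝ) := Real.rpow_pos_of_pos hβ0 2
  have e8 : β ^ (8 * (θ / 20)) = β ^ (θ / 2) * β ^ (-(θ / 10)) := by
    rw [← Real.rpow_add hβ0]; ring_nf
  have key : β ^ (-(2 + θ / 2)) ≤ c * κ ^ 2 / (256 * β ^ (8 * (θ / 20))) / β ^ 2 := by
    rw [e8, le_div_iff₀ (by positivity), le_div_iff₀ (by positivity)]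
    have hsplit : β ^ (-(2 + θ / 2)) * β ^ (2 : ℕ) * (256 * (β ^ (θ / 2) * β ^ (-(θ / 10)))) = 256 * β ^ (-(θ / 10)) := by
      rw [← Real.rpow_natCast β 2]
      have : β ^ (-(2 + θ / 2)) * β ^ ((2 : ℕ) : ℝ) * β ^ (θ / 2) = 1 := by
        rw [← Real.rpow_add hβ0, ← Real.rpow_add hβ0]; norm_num
      calc β ^ (-(2 + θ / 2)) * β ^ ((2 : ℕ) : ℝ) * (256 * (β ^ (θ / 2) * β ^ (-(θ / 10))))
          = 256 * (β ^ (-(2 + θ / 2)) * β ^ ((2 : ℕ) : ℝ) * β ^ (θ / 2)) * β ^ (-(θ / 10)) := by ring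
        _ = 256 * β ^ (-(θ / 10)) := by rw [this, mul_one]
    rw [hsplit]
    linarith
  have hfin : c * κ ^ 2 / (256 * β ^ (8 * (θ / 20))) / β ^ 2 ≤ boxPlaqCov (fundamentalRep (Fin 2)) β ⌈β ^ θ⌉₊ ⌈β ^ (θ / 20)⌉₊ := by
    rw [div_le_iff₀ (by positivity)]
    linarith
  exact key.trans hfin

end Summit.QuantumFields.YangMills.Theorems.WeakCouplingRates
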